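import Summits.ResolutionOfSingularities.ResolutionOfSingularities.Theorems.WildConesCampaignW46ForcedAtomRegime
import Summits.ResolutionOfSingularities.ResolutionOfSingularities.Theorems.MarkedTransferCampaignW46FiniteExitBound
import HarnessLib

/-!
# [OURS · L1 W4.6, rung (i)/(all `n`), GEOMETRIC FORM] The regime «FORCED ATOMS WITH FINITELY MANY SINGULAR POINTS in
# `n + 1` variables» of the typed Th. 16.6 procedure, NAMED, and its rungs
# (cell res-hironaka, LADDER-RESOLUTION rung L, D-0089; slot W4.6, seat res-L1-s46-pv-2 gen 5; host route `WildCones`,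
# crux `ClassicalRegimes` stmt-ResolutionOfSingularities-16884, `--kind definition --supports … --as helper`)

HONEST FRAMING. Everything below is OURS. NOTHING here is a statement of H. Hironaka's manuscript *Resolution of
singularities in positive characteristics* (2017-03-23, [Hironaka2017]) and nothing asserts that any statement of it
holds: the typed Th. 16.6 procedure (`CampaignW46.Terminates`, `Regime` — res-L1-type-o1,
`Theorems/MarkedTransferCampaignW46TypedProcedure.lean`), its résumé-free forms (`PermissiblyTerminates`,
`FinLocalExitBound` — res-L1-s46-pv-1 / o1), the regimes `Regime.isolatedSing` (pv-1) and `Regime.forcedAtom` (o1,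
p517839) and the candidate carriers (`AmbientDatum`, `IdealExponent`, `.sing`, `stalkIdeal`) enter as DEFINITIONS; the
coefficient calculus is route `WildCones`' own (`WildCones.ser`, `WildCones.Isol`). No FACT-LIST premise is used.
STATEMENT-ONLY module (definitions and `Iff.rfl`/pure-logic unfoldings); the closers are this seat's
`Theorems/WildConesCampaignW46ForcedAtomsFiniteSing.lean` (`finLocalExitBound_of_le_forcedAtomsSurface`, `…Curve`) and
are linked BY NAME in a companion file once both have landed. AI review is weaker than expert review.

## What this file defines

* §1 `Regime.forcedAtomsFin n : Regime p K` — [OURS · L1 W4.6 rung (i)/(all `n`), geometric form] THE FINITE-`Sing`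
  FORCED-ATOM CLASS: at a state `(A, E)`, `E.b = p`; `Sing(E)` is a FINITE set of CLOSED points (`Regime.isolatedSing`);
  and at every `ξ ∈ Sing(E)`: embedding dimension `n + 1`, SOME presentation `𝒪̂_{Z,ξ} ≅ K⟦z,u₁,…,uₙ⟧` of `J_ξ` by a
  unit times a height-one atom `z^p − ser c₀`, and EVERY such presentation isolated (`Isol c₀`) — VERBATIM the germ
  clauses of `Regime.forcedAtom n` (p517839), with its clause «`Sing(E)` is a subsingleton» REPLACED by «`Sing(E)` finite,
  of closed points». Replaces the role of the restriction «regime (i): surfaces / forced `p`-fold hypersurface points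
  `z^p = a(u)`» of RESCUE-SEED W4.6 read GEOMETRICALLY (a surface in a smooth threefold may carry any finite number of
  isolated forced points, and a blow-up may create several); NOT a statement of the manuscript.
* §2 `ForcedAtomsFinFinLocalExitBound p K n`, `ForcedAtomsFinPermissiblyTerminates p K n`, `ForcedAtomsFinTerminates p K n`
  — the rung in its three shapes (finite-sequence exit bound; résumé-free termination; typed termination for every
  `m`, `N : Notions.{0} m`, `Rd`).
* §3 pure logic: `Regime.forcedAtomsFin_apply` (unfolding), `forcedAtomsFin_of_forcedAtom` (o1's regime with closed
  singular points is contained in the class), `forcedAtomsFinTerminates_of_permissibly`.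

VACUITY. (a) The class is inhabited: this seat's Fermat witnesses (`AffineFermat.regime_forcedAtom`, bricks 25/26; the
origin of `𝔸^{n+1}` is a closed point) lie in it for every `n` (proved in the companion
`…ForcedAtomsFiniteSingWitness.lean`, not here). (b) `FinLocalExitBound`/`Terminates` are trivially true on an empty
regime — whence (a). (c) The closers need `K` algebraically closed and `n ∈ {1, 2}` (no branching bound is proved for
`n ≥ 3`); `K` perfect non-closed is OPEN (residue (R1) of HOME/L/res-L1-s46-pv-2/RUNG-I-FORCED-ATOM-SUMMARY.md).

References: res-L1-type-o1 p517839 (`Regime.forcedAtom`), res-L1-s46-pv-1 (`Regime.isolatedSing`, p477752), o1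
p488284 (`FinLocalExitBound`); this seat's bricks 27–34; H. Hironaka, ms. 2017, Th. 16.6 p.84, Th. 16.13 p.87 l.26–28
(ROLE only; nothing asserted). [folklore]
-/

noncomputable section

-- single-problem summit: the doubled namespace component `ResolutionOfSingularities` is forced
set_option linter.dupNamespace false

open scoped BigOperators Classical
open MvPowerSeries IsLocalRing

namespace Summit.ResolutionOfSingularities.ResolutionOfSingularities.Theorems

namespace CampaignW46

open CategoryTheory AlgebraicGeometry TopologicalSpace
open Literature.AlgebraicGeometry.Resolution
open Literature.AlgebraicGeometry.Hironaka2017.S02Preliminaries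
open Scheme.IdealSheafData
open WildCones

variable {p : ℕ} [Fact p.Prime] {K : Type} [Field K] [CharP K p]

/-! ## §1 The finite-`Sing` forced-atom regime -/

/-- [OURS · L1 W4.6 rung (i)/(all `n`), geometric form] **Regime «forced atoms with finitely many singular points in
`n + 1` variables»** — `Regime.forcedAtom n` (p517839) with «`Sing(E)` subsingleton» replaced by «`Sing(E)` finite, of
closed points» (`Regime.isolatedSing`); the germ clauses are verbatim. See the module docstring; NOT a statement of the
manuscript. [folklore] -/
def Regime.forcedAtomsFin (n : ℕ) : Regime p K := fun A E =>
  E.b = p ∧ Regime.isolatedSing A E ∧ ∀ ξ ∈ E.sing,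
    (maximalIdeal (A.Z.presheaf.stalk ξ)).spanFinrank = n + 1 ∧
    (∃ (E₀ : AdicCompletion (maximalIdeal (A.Z.presheaf.stalk ξ)) (A.Z.presheaf.stalk ξ) ≃+*
        MvPowerSeries (Option (Fin n)) K)
      (f₀ : A.Z.presheaf.stalk ξ) (c₀ : (Fin n → ℕ) → K) (w₀ : MvPowerSeries (Option (Fin n)) K),
      stalkIdeal E.J ξ = Ideal.span {f₀} ∧ IsUnit w₀ ∧
        E₀ (algebraMap _ _ f₀) = w₀ * ((X none : MvPowerSeries (Option (Fin n)) K) ^ p -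
          rename (some : Fin n → Option (Fin n)) (ser p n K c₀))) ∧
    (∀ (E₀ : AdicCompletion (maximalIdeal (A.Z.presheaf.stalk ξ)) (A.Z.presheaf.stalk ξ) ≃+*
        MvPowerSeries (Option (Fin n)) K)
      (f₀ : A.Z.presheaf.stalk ξ) (c₀ : (Fin n → ℕ) → K) (w₀ : MvPowerSeries (Option (Fin n)) K),
      stalkIdeal E.J ξ = Ideal.span {f₀} → IsUnit w₀ →
        E₀ (algebraMap _ _ f₀) = w₀ * ((X none : MvPowerSeries (Option (Fin n)) K) ^ p -
          rename (some : Fin n → Option (Fin n)) (ser p n K c₀)) → Isol p n K c₀)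

/-! ## §2 The rung in its three shapes -/

/-- [OURS · L1 W4.6 rung (i)/(all `n`), geometric form; NOT a statement of the manuscript] The FINITE-SEQUENCE EXIT-BOUND
shape: `FinLocalExitBound (Regime.forcedAtomsFin n)`. Closed by name for `n ∈ {1, 2}`, `K` algebraically closed
(companion closer file, from this seat's `finLocalExitBound_of_le_forcedAtoms{Curve,Surface}`). [folklore] -/
def ForcedAtomsFinFinLocalExitBound (p : ℕ) [Fact p.Prime] (K : Type) [Field K] [CharP K p] (n : ℕ) : Prop :=
  FinLocalExitBound (Regime.forcedAtomsFin (p := p) (K := K) n)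

/-- [OURS · L1 W4.6 rung (i)/(all `n`), geometric form; NOT a statement of the manuscript] The RÉSUMÉ-FREE shape: no
infinite §2.1-permissible sequence of blow-ups stays inside `Regime.forcedAtomsFin n`. [folklore] -/
def ForcedAtomsFinPermissiblyTerminates (p : ℕ) [Fact p.Prime] (K : Type) [Field K] [CharP K p] (n : ℕ) : Prop :=
  PermissiblyTerminates (Regime.forcedAtomsFin (p := p) (K := K) n)

/-- [OURS · L1 W4.6 rung (i)/(all `n`), geometric form; NOT a statement of the manuscript] The TYPED shape: the typed
Th. 16.6 procedure terminates in `Regime.forcedAtomsFin n` for every `m`, every notion instance `N : Notions.{0} m` and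
every reading `Rd` (shape of o1's `ForcedAtomTerminates`). [folklore] -/
def ForcedAtomsFinTerminates (p : ℕ) [Fact p.Prime] (K : Type) [Field K] [CharP K p] (n : ℕ) : Prop :=
  ∀ (m : ℕ) (N : Notions.{0} m) (Rd : Reading p K N), Terminates N Rd (Regime.forcedAtomsFin (p := p) (K := K) n)

/-! ## §3 Pure logic -/

/-- Unfolding `Regime.forcedAtomsFin` at a state (definitional). [folklore] -/
theorem Regime.forcedAtomsFin_apply (n : ℕ) (A : AmbientDatum p K) (E : IdealExponent A.Z) :
    Regime.forcedAtomsFin (p := p) (K := K) n A E ↔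
      E.b = p ∧ Regime.isolatedSing A E ∧ ∀ ξ ∈ E.sing,
        (maximalIdeal (A.Z.presheaf.stalk ξ)).spanFinrank = n + 1 ∧
        (∃ (E₀ : AdicCompletion (maximalIdeal (A.Z.presheaf.stalk ξ)) (A.Z.presheaf.stalk ξ) ≃+*
            MvPowerSeries (Option (Fin n)) K)
          (f₀ : A.Z.presheaf.stalk ξ) (c₀ : (Fin n → ℕ) → K) (w₀ : MvPowerSeries (Option (Fin n)) K),
          stalkIdeal E.J ξ = Ideal.span {f₀} ∧ IsUnit w₀ ∧
            E₀ (algebraMap _ _ f₀) = w₀ * ((X none : MvPowerSeries (Option (Fin n)) K) ^ p -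
              rename (some : Fin n → Option (Fin n)) (ser p n K c₀))) ∧
        (∀ (E₀ : AdicCompletion (maximalIdeal (A.Z.presheaf.stalk ξ)) (A.Z.presheaf.stalk ξ) ≃+*
            MvPowerSeries (Option (Fin n)) K)
          (f₀ : A.Z.presheaf.stalk ξ) (c₀ : (Fin n → ℕ) → K) (w₀ : MvPowerSeries (Option (Fin n)) K),
          stalkIdeal E.J ξ = Ideal.span {f₀} → IsUnit w₀ →
            E₀ (algebraMap _ _ f₀) = w₀ * ((X none : MvPowerSeries (Option (Fin n)) K) ^ p -
              rename (some : Fin n → Option (Fin n)) (ser p n K c₀)) → Isol p n K c₀) :=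
  Iff.rfl

/-- Pure logic: a state of o1's `Regime.forcedAtom n` (at most one singular point) whose singular points are CLOSED lies
in `Regime.forcedAtomsFin n` — the geometric class extends the old regime. [folklore] -/
theorem forcedAtomsFin_of_forcedAtom {n : ℕ} {A : AmbientDatum p K} {E : IdealExponent A.Z}
    (h : Regime.forcedAtom (p := p) (K := K) n A E)
    (hcl : E.sing ⊆ Literature.AlgebraicGeometry.Hironaka2017.S02Preliminaries.closedPoints A.Z) :
    Regime.forcedAtomsFin (p := p) (K := K) n A E :=
  ⟨h.1, ⟨h.2.1.finite, hcl⟩, h.2.2⟩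

/-- Pure logic: in the class the exponent is the characteristic and the singular locus is finite. [folklore] -/
theorem Regime.forcedAtomsFin_sing_finite {n : ℕ} {A : AmbientDatum p K} {E : IdealExponent A.Z}
    (h : Regime.forcedAtomsFin (p := p) (K := K) n A E) : E.b = p ∧ E.sing.Finite :=
  ⟨h.1, h.2.1.1⟩

/-- Pure logic: the résumé-free rung gives the typed rung (pv-1's `terminates_of_permissiblyTerminates`). [folklore] -/
theorem forcedAtomsFinTerminates_of_permissibly {n : ℕ} (h : ForcedAtomsFinPermissiblyTerminates p K n) :
    ForcedAtomsFinTerminates p K n :=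
  fun _ N Rd => terminates_of_permissiblyTerminates N Rd h

/-- Pure logic: the exit-bound rung gives the résumé-free rung (o1's `permissiblyTerminates_of_finLocalExitBound`, the
singular loci being finite in the class). [folklore] -/
theorem forcedAtomsFinPermissiblyTerminates_of_finLocalExitBound {n : ℕ} (h : ForcedAtomsFinFinLocalExitBound p K n) :
    ForcedAtomsFinPermissiblyTerminates p K n :=
  permissiblyTerminates_of_finLocalExitBound (fun _ _ hE => hE.2.1.1) h

end CampaignW46

end Summit.ResolutionOfSingularities.ResolutionOfSingularities.Theorems

end
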